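import Mathlib
import Literature.Analysis.FluidPDE.ClassicalSolution
import Literature.Analysis.FluidPDE.ClassicalSolutionCalculus
import Literature.Analysis.FluidPDE.PressureNormalisationL3

/-!
# Crux `LandauTail.LandauTailBlowup` (stmt-NavierStokesRegularity-1944), line `registered`, cycle c7:
  stub `landauTail_momentum_hasDerivAt` (W2) — the exact local momentum law of a classical flow

Helper file on the proof path of the crux item `stmt-NavierStokesRegularity-1944`
(`Summit.NavierStokesRegularity.NavierStokesRegularity.Theses.LandauTail.LandauTailBlowup`), lead c7: the
registered support stub `landauTail_momentum_hasDerivAt`. For a classical unit-viscosity solution `(v, q)` of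
the unforced Navier–Stokes system on `ℝ³ × (−1, 0)` and a smooth compactly supported divergence-free test
field `φ`, the local momentum `M(t) = ∫ ⟪v(t, x), φ(x)⟫ dx` satisfies
`M'(t) = ∫ (⟪v, (v·∇)φ⟫ + ⟪v, Δφ⟫)` at every `t ∈ (−1, 0)`, and the flux on the right is continuous on
`(−1, 0)`.

Proof: differentiate under the integral (`PressureNormalisationL3.hasDerivAt_integral_inner_velocity`:
`M'(t) = ∫ ⟪∂ₜv(t), φ⟫`), then use the slice identity behind the weak formulation
(`IsClassicalNSSolutionOn.integral_inner_timeDerivWithin_test`, Leray 1934 (17): insert the momentum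
equation and integrate by parts on `ℝ³`; the pressure drops out since `div φ = 0`) with `ν = 1`, `f = 0`.
Continuity of the flux is that of `t ↦ ∫ ⟪∂ₜv(t), φ⟫`
(`PressureNormalisationL3.continuousOn_integral_inner_timeDerivWithin`) transported along the same identity.

* `landauTail_momentum_flux_eq_integral_inner_timeDerivWithin` — the slice identity at `ν = 1`, `f = 0`;
* `landauTail_momentum_hasDerivAt` — the registered stub.
-/

set_option linter.dupNamespace false

noncomputable section

open MeasureTheory Set Function Filter
open scoped Topology RealInnerProductSpace Laplacian ContDiff
open Literature.Analysis.FluidPDE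

namespace Summit.NavierStokesRegularity.NavierStokesRegularity.Theorems

/-- **The momentum flux through the equation.** For a classical unit-viscosity solution `(v, q)` of the
unforced system on `(−1, 0)` and a smooth compactly supported divergence-free `φ`, at every `t ∈ (−1, 0)`:
`∫ ⟪∂ₜv(t), φ⟫ = ∫ (⟪v, (v·∇)φ⟫ + ⟪v, Δφ⟫)` (the slice identity behind Leray's weak relation (17),
specialised to `ν = 1`, `f = 0`). [folklore] -/
theorem landauTail_momentum_flux_eq_integral_inner_timeDerivWithin
    {v : ℝ → EuclideanSpace ℝ (Fin 3) → EuclideanSpace ℝ (Fin 3)}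
    {q : ℝ → EuclideanSpace ℝ (Fin 3) → ℝ} {φ : EuclideanSpace ℝ (Fin 3) → EuclideanSpace ℝ (Fin 3)}
    (h : IsClassicalNSSolutionOn (Ioo (-1 : ℝ) 0) 1 0 v q) (hφ : ContDiff ℝ ∞ φ)
    (hφc : HasCompactSupport φ) (hdiv : ∀ x, VectorCalculus.divergence φ x = 0) {t : ℝ}
    (ht : t ∈ Ioo (-1 : ℝ) 0) :
    ∫ x, ⟪timeDerivWithin (Ioo (-1 : ℝ) 0) v t x, φ x⟫ =
      ∫ x, (⟪v t x, convect (v t) φ x⟫ + ⟪v t x, (Δ φ) x⟫) := by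
  rw [h.integral_inner_timeDerivWithin_test isOpen_Ioo.uniqueDiffOn ht (contDiff_infty.1 hφ 2) hφc
    hdiv]
  refine integral_congr_ae (Eventually.of_forall fun x => ?_)
  simp

/-- **W2 — local momentum balance of a classical flow** (Fefferman (1)–(2) tested against a
time-independent solenoidal field): for a classical unit-viscosity solution `(v, q)` of the unforced system
on `ℝ³ × (−1,0)` and a smooth compactly supported divergence-free `φ`, `t ↦ ∫⟪v(t), φ⟫` is differentiable
on `(−1,0)` with derivative `∫ (⟪v, (v·∇)φ⟫ + ⟪v, Δφ⟫)` (differentiate under the integral, insert the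
momentum equation, integrate by parts; the pressure drops out because `div φ = 0`); the flux
`t ↦ ∫ (⟪v, (v·∇)φ⟫ + ⟪v, Δφ⟫)` is continuous on `(−1,0)`. [folklore] -/
theorem landauTail_momentum_hasDerivAt : ∀ (v : ℝ → EuclideanSpace ℝ (Fin 3) → EuclideanSpace ℝ (Fin 3)) (q : ℝ → EuclideanSpace ℝ (Fin 3) → ℝ) (φ : EuclideanSpace ℝ (Fin 3) → EuclideanSpace ℝ (Fin 3)), Literature.Analysis.FluidPDE.IsClassicalNSSolutionOn (Set.Ioo (-1) 0) 1 0 v q → ContDiff ℝ (⊤ : ℕ∞) φ → HasCompactSupport φ → (∀ x, Literature.Analysis.FluidPDE.VectorCalculus.divergence φ x = 0) → (∀ t ∈ Set.Ioo (-1 : ℝ) 0, HasDerivAt (fun s : ℝ => ∫ x, inner ℝ (v s x) (φ x)) (∫ x, (inner ℝ (v t x) (Literature.Analysis.FluidPDE.convect (v t) φ x) + inner ℝ (v t x) (Laplacian.laplacian φ x))) t) ∧ ContinuousOn (fun t : ℝ => ∫ x, (inner ℝ (v t x) (Literature.Analysis.FluidPDE.convect (v t) φ x) + inner ℝ (v t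 x) (Laplacian.laplacian φ x))) (Set.Ioo (-1 : ℝ) 0) := by
  intro v q φ h hφ hφc hdiv
  refine ⟨fun t ht => ?_, ?_⟩
  · have hD := PressureNormalisationL3.hasDerivAt_integral_inner_velocity h isOpen_Ioo hφ hφc ht
    rwa [landauTail_momentum_flux_eq_integral_inner_timeDerivWithin h hφ hφc hdiv ht] at hD
  · refine (PressureNormalisationL3.continuousOn_integral_inner_timeDerivWithin h isOpen_Ioo
      hφ.continuous hφc).congr fun t ht => ?_
    exact (landauTail_momentum_flux_eq_integral_inner_timeDerivWithin h hφ hφc hdiv ht).symm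

end Summit.NavierStokesRegularity.NavierStokesRegularity.Theorems

end
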